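import Mathlib
import HarnessLib
import HarnessLib.Audit
import Summits.HodgeConjecture.Statement
import Literature.AlgebraicGeometry.HodgeTheory.GysinFormalism
import Summits.HodgeConjecture.HodgeConjecture.Theorems.LinearSystemTorelliHardLefschetzReduction
import Summits.HodgeConjecture.HodgeConjecture.Theorems.HolomorphicDefectHodgeModelsExist
import HarnessLib.Audit.Status.Attr

/-!
Route: AmpleAdicLefschetz

CLOSED (exhausted) 2026-08-17T11:19:29Z by planner-rbadge-HodgeConjecture-AmpleAdicLefsch-43de99fd-g3-0 — reason: exhausted — note: route-repair g3 (badge, needs_repair skeleton.hides-summit): NOT A THESIS any more — crux #3 SectionalSource ↔ HodgeConjecture is a landed theorem (Theorems/AmpleAdicLefschetzSectionalSourceIffHodgeConjecture.lean, ampleAdicLefschetz_sectionalSource_iff_hodgeConjecture, p155811: SS at (2p+1,p) on X0. The file is kept as the record of this route; refuted decls are indexed as negative knowledge (`ledger negatives`).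

# Route AmpleAdicLefschetz — Algebraicity descends from ample sections — Grothendieck–Lefschetz for
cycle classes (THICK) plus one special section per Hodge class

It suffices to show X = THICK ∧ SS (realises card ample-adic-thickening-weak-lefschetz; X has two
parts).
THICK (decl ThickDescent): for a closed immersion f : Y ⟶ X of smooth projective complex varieties
whose complement X∖Y is
covered by k affine opens (k = 1: a smooth divisor with affine complement, e.g. a smooth AMPLE
divisor; k ample divisors cut out a
complete intersection) and 2p + k ≤ dim X, every ALGEBRAIC class on Y lying in the image of f^* :
H^{2p}(X(ℂ);ℂ) → H^{2p}(Y(ℂ);ℂ)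
is f^* of an ALGEBRAIC class of X — Grothendieck–Lefschetz one codimension up: the homological
shadow of Hartshorne's weak
Lefschetz conjecture for Chow groups (surjectivity half, Lefschetz range 2p < dim Y) extended to the
boundary degree 2p = dim Y.
SS (decl SectionalSource): every rational (p,p) class c on X with 2p+1 ≤ dim X becomes algebraic on
at least ONE such PROPER Y ⊂ X
(X∖f(Y) ≠ ∅ is a clause of the decl since rev 3: the filed `0 < s.card` alone admitted Y = X, s =
{⊥} — refuter reviews 12:29Z/13:59Z).
Reading: for the algebraicity locus J(c) = {admissible sections Y : f^*c ∈ Alg(Y)}, SS says J(c) ≠ ∅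
and THICK says J(c) ≠ ∅ ⇒ c
algebraic (J(c) is all or nothing); HC ⇔ THICK ∧ SS modulo the weak Lefschetz theorem and the degree
bookkeeping (support items).
Lean: `ThickDescent ∧ SectionalSource` (the two crux decls below, on real carriers complexBetti.map
/ algebraicClasses / IsClosedImmersion / IsAffineOpen). Deciding theorem (D-0027 §2.1, end of this
file, sorry-free): `closes : ThickDescent → SectionalSource → WeakLefschetzInjective →
HardLefschetzReduction → MiddleStabilisation → HodgeModelsExist → HodgeConjecture`.

## Assembly
The deciding theorem `closes` (planner glue.lean, rendered at the end of this file; pure logic + Nat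
arithmetic over the items,
axioms propext/Classical.choice/Quot.sound; planner Sketch.lean rc 0). Given X smooth projective of
dim n: the HodgeModel conjunct
of HodgeConjectureFor is the item HodgeModelsExist — needs-fact:
Literature.AlgebraicGeometry.HodgeTheory.nonempty_hodgeModel,
GENUINELY needed (it is conjunct 1 of the summit statement, so every route to HodgeConjecture must
produce it); the item is that
named fact with its binders spelled out (defeq), closable in one line `fun n X =>
nonempty_hodgeModel_holds` once the Literature
discharge (HodgeModelExistenceDischarge) lands, and this file no longer imports HodgeModelExistence,
so the unproved fact is carried
by the item and not by the import cone (route-repair 2026-08-15). For a rational (p,p) class c: if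
2p + 1 ≤ n, SectionalSource gives
(Y, f, s) with f^*c algebraic, ThickDescent gives a ∈ Alg(X) with f^*a = f^*c,
WeakLefschetzInjective (j = 2p, 2p + |s| ≤ n) gives
a = c. If 2p = n, MiddleStabilisation reduces to the previous case in dimension 2p + 1. If 2p > n,
HardLefschetzReduction reduces to
degree 2(n − p) ≤ n (omega), i.e. to one of the two previous cases (degree 0 included: 2·0 + 1 ≤ n
or n = 0 = 2·0). The item
`Assembly` (HodgeModelsExist → WeakLefschetzInjective → HardLefschetzReduction → MiddleStabilisation
→ ThickDescent → SectionalSource →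
HodgeConjecture) is `closes` re-curried and is provable now in one line from it.

Rationale: WHY THIS LINE. Mechanism (formal geometry + deformation theory brought to bear on a FIXED variety):
Grothendieck proved Pic X = Pic X̂ = Pic Y
along an ample divisor (Grothendieck1968SGA2 Exp. X–XII; Hartshorne1970 Ch. IV, Prop. 1.1 and Thm
1.5 READ pp.93,100: Leff(X,Y)
for complete intersections of dim ≥ 2); one codimension up the same scheme is Hartshorne1974Cycles'
weak Lefschetz conjecture
for Chow groups (Sathyamoorthy2018WeakLefschetz Conj. 1 READ p.1), whose FORMAL half is a theorem
(PatelRavindra2014,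
PatelRavindra2017, Sathyamoorthy2018WeakLefschetz via van der Kallen + Kodaira–Nakano) and whose
algebraization half is open;
THICK asks only for the image modulo homological equivalence with ℚ-coefficients, which is exactly
what HC needs and exactly what
HC predicts (support ThickNecessary). Two member-by-member engines exist for THICK at a given
section Y: (E1, the card) lift a
representative OBJECT (vector bundle / lci cycle of dim ≥ 2; dim Y ≥ 3) through the Y-adic tower Y ⊂
Y₂ ⊂ … where the obstruction groups
Ext²_Y(F, F ⊗ N^{-m}) VANISH for m ≫ 0 by Serre duality + Serre vanishing (finite window;
Griffiths1966Extension for positive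
normal bundles) and algebraize the formal object by Leff (Hartshorne1970 IV Prop 1.3/Thm 1.5, READ
pp.95,100: LOCALLY FREE formal sheaves
along a c.i. Y of dim ≥ 2 come from a neighbourhood U ⊇ Y, and X∖U is finite when Y is an ample
divisor; the extension of the
same presentation argument to perfect complexes is part of the support item, not a quotation); (E2)
deform a semiregular representative inside the
universal family of sections (Bloch1972Semiregularity, BuchweitzFlenner2003, Pridham2024; the
Hilbert scheme algebraizes) and
descend. Planner's observation (grounder to check): for a VERY GENERAL member Y of a base-point-free
linear system THICK holds
UNCONDITIONALLY — spread the cycles over a relative Hilbert scheme, note that the incidence variety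
𝒴 → X is a projective bundle
so CH(𝒴)|_{Y_b} ⊆ r_b(CH X), and use the flat-section/monodromy argument of VoisinHodgeII2003 proof
of Thm 3.33 (READ
pp.107–108) — so the open content of THICK is concentrated on SPECIAL sections, precisely where SS
must find its witnesses and
precisely what E1/E2 (which do not care about genericity) attack. Relation to the parallel routes:
THICK is implied by
AnchorTransport.VariationalHodge restricted to section families plus the generic descent above
(weaker, cheaper, two extra
engines with a finite window); SS looks for anchors INSIDE X (sections vary in positive-dimensional
families even when X is
rigid, where AnchorTransport.AnchorExistence degenerates to HC(X)); NodalSupport/Thomas2005Nodes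
uses SINGULAR sections and
support (coniveau 1), we use SMOOTH sections and extension. Imported areas: SGA2 formal geometry,
coherent deformation theory,
Noether–Lefschetz/Hodge-locus theory for the geography of J(c). Negatives index: empty at filing.

RANKED CRUXES. #0 Target (target) — X = THICK ∧ SS: algebraicity descends from affine-complement
sections in the range 2p + k ≤ dim X, and every Hodge class is algebraic on at least one proper such
section. (why it might fail: Jointly of HC strength (HC ⇒ THICK by semisimplicity of polarisable
Hodge structures; HC ⇒ SS via Bertini + pull-back); fails iff HC fails. SS alone fails for a
'sectionally isolated' Hodge class.) [Hartshorne1974Cycles, Sathyamoorthy2018WeakLefschetz,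
VoisinHodgeII2003, Deligne2000]
#2 ThickDescent (crux) — THICK (card Lemma 1 / THICK and THICK' merged): f : Y ⟶ X a closed
immersion of smooth projective ℂ-varieties (dim X = n, dim Y = m), s a finite set of affine opens of
X covering exactly X∖f(Y), 2p + |s| ≤ n; then every c ∈ algebraicClasses Y p that lies in the range
of f^* on H^{2p} equals f^*a for some a ∈ algebraicClasses X p. Covers smooth ample divisors (|s| =
1, 2p ≤ dim Y: Lefschetz range and boundary) and smooth complete intersections of |s| ample
divisors; trivial for |s| = 0 (f iso). ℚ/ℂ-coefficients, modulo homological equivalence only.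
[difficulty: open-problem] (why it might fail: HC-implied (ThickNecessary), so false only with HC;
live risk is the engines: at SPECIAL sections unobstructed/semiregular representatives may not exist
(non-lci, Ext² ≠ 0 though the Hodge obstruction vanishes) and BEK-type algebraization of K-classes
is open.) [Hartshorne1974Cycles, Sathyamoorthy2018WeakLefschetz, PatelRavindra2014,
PatelRavindra2017, Hartshorne1970, Grothendieck1968SGA2, Bloch1972Semiregularity,
BuchweitzFlenner2003, BlochEsnaultKerz2014CharZero, Griffiths1966Extension, VoisinHodgeII2003,
Paranjape1994SmallChow]
#3 SectionalSource (crux) — SS: for X smooth projective of dim n, 2p + 1 ≤ n, and c a rational (p,p)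
class in H^{2p}(X(ℂ);ℂ), there exist a smooth projective Y of some dim m, a closed immersion f : Y ⟶
X with X∖f(Y) NON-EMPTY (a proper section) and a finite set s of affine opens of X covering exactly
X∖f(Y) with 2p + |s| ≤ n (hence 1 ≤ |s| ≤ n − 2p), such that f^*c ∈ algebraicClasses Y p. I.e. every
Hodge class below the middle becomes algebraic on some proper section of ample type (a smooth ample
divisor, or a smooth c.i. of ≤ n − 2p ample divisors, possibly very special: through a given p-fold,
Noether–Lefschetz-special, or a member where HC is known — Fano/uniruled fourfold sections by
ConteMurre1978, cubic fourfolds by Zucker1977CubicFourfolds, Fermat members). [difficulty: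
open-problem] (why it might fail: HC-strength given THICK: for very general sections f^*c algebraic
already forces c algebraic (spreading), so witnesses live in NL-special members — a countable union
of proper subvarieties (CDK; Voisin II 3.33); a rigid 'sectionally isolated' class kills it.)
[VoisinHodgeII2003, CattaniDeligneKaplan1995JAMS, Otwinowska2002, BaldiKlinglerUllmo2024,
ConteMurre1978, Zucker1977CubicFourfolds, Shioda1979HodgeFermat, Markman2025SecantWeil]
#9 WeakLefschetzInjective (support) — Weak Lefschetz, injectivity half, in affine-cover form: X
smooth projective of dim n, f : Y ⟶ X a closed immersion, X∖f(Y) covered by the k affine opens of s;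
then f^* : H^j(X(ℂ);ℂ) → H^j(Y(ℂ);ℂ) is injective for j + k ≤ n. Proof in print: U = X∖Y is a union
of k smooth affine varieties, all finite intersections affine (X separated), so H^i(U(ℂ)) = 0 for i
> n + k − 1 (Andreotti–Frankel, Voisin II Thm 1.22, + Mayer–Vietoris), Poincaré duality on U gives
H^j_c(U) = 0 for j ≤ n − k, and the compact-support sequence of (X, Y) gives injectivity (Voisin II
Thm 1.23 is the case k = 1). Needs on the tree's carriers: Mayer–Vietoris/compact supports for
singularCohomology of complex points, Andreotti–Frankel. [difficulty: L] [VoisinHodgeII2003,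
Milnor1963]
#9 HardLefschetzReduction (support) — (identical signature to NodalSupport's HardLefschetzReduction,
stmt-HodgeConjecture-1084 — dedup/attach intended) for n < 2p, HC for X in degree 2(n − p) implies
HC for X in degree 2p (hard Lefschetz L^{2p−n} is an isomorphism of Hodge structures carrying
rational/algebraic classes to rational/algebraic classes; Voisin I Thm 6.25, Kleiman1968).
[difficulty: L] [Kleiman1968, Thomas2005Nodes, KerrPearlstein2011]
#9 MiddleStabilisation (support) — Middle degree from one dimension up: if rational (p,p) classes
are algebraic on every smooth projective X' of dimension 2p + 1 (degree 2p, i.e. the range 2p + 1 ≤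
dim), then rational (p,p) classes are algebraic on every smooth projective X of dimension 2p. Proof
in print (folklore product trick): X' = X × ℙ¹ (IsSmoothProjective.tensor_holds,
isSmoothProjective_projectiveSpace_holds), c' = pr_X^* c is rational (IsRationalClass.map) and of
type (p,p) (pull-back of Hodge type — Literature lemma to add), c' algebraic by hypothesis, c =
s^*c' for the section s = (id, pt), and pull-back preserves algebraic classes
(QbarEnvelope.PullbackAlgebraic, Fulton §8.1/Cor. 19.2). [difficulty: M] [Fulton1998, Kleiman1968,
VoisinHodgeI2002]
#9 ThickNecessary (support) — THICK is a CONSEQUENCE of the Hodge conjecture (so ¬ThickDescent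
refutes the summit): given HC and c ∈ Alg^p(Y) ∩ im f^*, write Alg^p(Y)_ℂ ∩ im f^*_ℂ = (Alg^p(Y)_ℚ ∩
im f^*_ℚ) ⊗ ℂ (both subspaces are ℚ-rational: supportedClasses are spanned by rational classes,
SupportedClassesRational; universal coefficients), lift each rational Hodge generator through f^* to
a rational (p,p) class of X using semisimplicity of polarisable ℚ-Hodge structures (H^{2p}(X) = ker
f^* ⊕ M, f^*|_M strict injective), and apply HC on X. Needs on the tree: algebraic ⇒ Hodge
(Grothendieck1969 fact supportedClasses_le_hodgeConiveau + conjugation), polarisation/semisimplicity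
for HodgeModel. [difficulty: L] [Deligne2000, VoisinHodgeI2002, CharlesSchnell2014Notes]
#9 ThickCodimOne (support) — Calibration p = 1 of ThickDescent (literally its instance, and a
THEOREM in print): divisor classes on Y in the image of f^* come from divisor classes on X —
Lefschetz (1,1) on X and Y (tree fact lefschetzOneOne_rational) plus the semisimplicity lift of
ThickNecessary; for Y a smooth ample divisor of dim ≥ 3 this is Grothendieck–Lefschetz Pic ⊗ ℚ
modulo homological equivalence (Hartshorne1970 IV Cor. 3.3). [difficulty: M] [Hartshorne1970,
Grothendieck1968SGA2, VoisinHodgeI2002]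
#4 HadicSemiregularLiftR (crux, informal, stmt-HodgeConjecture-13870; replaces HadicSemiregularLift
stmt-HodgeConjecture-2686, refuted-misstated 2026-08-15 and dropped) — the ENGINE of ThickDescent at
a fixed smooth AMPLE divisor Y (dim Y = d ≥ 3, 2p < d), for VECTOR-BUNDLE representatives only, up
to positive integer multiples of RATIONAL classes, with per-summand all-degree normalisation: (M)
Y-adic semiregularity — the N^{−m}-twisted Buchweitz–Flenner map σ^{(m)} carries the
bundle-extension obstruction ob_m ∈ H²(Y, 𝓔nd E₀ ⊗ N^{−m}) to the obstruction to lifting the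
Hodge-filtered Chern character from Y_{m−1} to Y_m, which vanishes for classes restricted from X
(Akizuki–Nakano: only components d ≤ 2q ≤ 2d−2 of σ^{(m)} are non-zero); (S) window-semiregular
normalised representatives span Alg^p(Y)_ℚ. With the in-print clauses (i) finite window
(Griffiths1966Extension; empty window = RavindraTripathi2013Extensions,
Cesnavicius2020GLVectorBundles) and (iii) Leff for locally free formal sheaves (Hartshorne1970 IV
1.3/1.5) it gives ThickDescent at (X, Y, p), |s| = 1, 2p < d. (why it might fail: semiregular
representatives may not exist; σ^{(m)} sees only d ≤ 2q ≤ 2d−2; the embedded formula (M) is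
unprinted; above the middle Hodge-to-de Rham injectivity on Y_m is open, so lifts may need
steering.) [Bloch1972Semiregularity, BuchweitzFlenner2003, Pridham2024,
BlochEsnaultKerz2014CharZero, Hartshorne1970, Grothendieck1968SGA2, Griffiths1966Extension,
RavindraTripathi2013Extensions, Cesnavicius2020GLVectorBundles, PatelRavindra2014,
PatelRavindra2017, arXiv:1801.08610]

TWO-LAYER PLAN. ThickDescent ⇐ FiniteWindow → HadicSemiregularLiftR → LeffAlgebraization →
ThickDescent|(Y a smooth ample divisor, d = dim Y ≥ 3, 2p < d) (k ≤ 3, to be filed as a glued split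
once defn-VectorBundleExtensionObstruction / defn-TwistedSemiregularityMap land and the engine is
typed): FiniteWindow (support, provable in print, VECTOR BUNDLES ONLY: for E₀ locally free on Y the
groups H^i(Y, 𝓔nd E₀ ⊗ N^{−m}), i = 1, 2, vanish for m > m₀(E₀) by Serre duality (d ≥ 3) + Serre
vanishing, so only ob₁ … ob_{m₀} can obstruct and the formal bundle is finitely determined — FALSE
for skyscrapers / general perfect complexes (refuter 13:59Z, 20:08Z on stmt-2686: Ext^i(O_y, O_y ⊗
N^{−m}) ≅ Λ^i T_y for every m), which is why the engine is typed for bundles; vector-bundle classes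
span Alg ⊗ ℚ, so no loss — contrast the p-adic/base-direction towers where the group is the same at
every order); HadicSemiregularLiftR (crux #4 above: mechanism (M) + (S), NOT the existential form
'some representative has vanishing Y-adic obstructions', which merely restates ThickDescent
restricted to ample divisors — refuter 20:08Z §1); LeffAlgebraization (support: Hartshorne1970 IV
Prop 1.3/Thm 1.5, READ pp.95,100 — Leff(X, Y) for LOCALLY FREE formal sheaves along Y with N ample
and dim Y ≥ 2, via |kY| very ample; Leff is FALSE for perfect complexes on X̂ (refuter 20:08Z: the
transcendental formal curve x₁ = sin x₄ in (ℙ⁴)^ along ℙ³ carries a perfect O_𝒞 lifting O_P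
compatibly that is not algebraizable), so no extension beyond bundles is attempted — then extension
across the finite set X∖U with ch_p unchanged; the p = 1 prototype is IV Thm 3.1/Cor 3.3, READ
pp.102–103, where H^i(Y, I^n/I^{n+1}) = 0 for i = 1, 2 and ALL n by Kodaira: an empty obstruction
window). Boundary degree 2p = dim Y (which closes DOES use, at n = 2p + 1 with |s| = 1): the
infinitesimal Noether–Lefschetz theorem for Chow groups (PatelRavindra2017) replaces the formal
uniqueness; first non-classical instance of the engine proper: d = 5, p = 2. SectionalSource ⇐ split
by witness type once one instance lands: sections through a prescribed p-fold with cancelling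
vanishing component; NL-special members; known-HC members (uniruled fourfold sections,
Fermat/Delsarte sections).

KILL CRITERIA. ¬ThickDescent proved for one (X, Y, p, c) refutes the Hodge conjecture itself
(ThickNecessary; route closes refuted:ThickDescent and
the summit is decided negatively). ¬SectionalSource for a concrete (X, c) with HC open there kills
the route AS A STRATEGY (pivot:
anchors outside X = AnchorTransport; or singular sections = NodalSupport). Engine death (forces
dropping HadicSemiregularLiftR and leaves THICK to the V-engine, i.e. supersession by
AnchorTransport): either (S) fails on the calibration X = A × ℙ², A a Weil-type abelian fourfold (HC
known by Markman2025SecantWeil), H ∈ |Θ ⊠ O(2)| (d = 5, p = 2) — every normalised virtual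
vector-bundle representative of r(Weil × [ℙ²]) of bounded regularity has σ^{(m)} non-injective on
H²(𝓔nd Eᵢ ⊗ N^{−m}) for some m ≤ m₀(Eᵢ) although the class descends — or (M) fails in its first case
(a window-semiregular normalised bundle on some Y₀ that does not extend to Y₁ = 2Y). A grounder
disproving the 'generic THICK' observation (Why this line) forces a rewrite of
the rationale, not of the items.

NOT DECOMPOSED YET. The engine split of ThickDescent (needs definitions: infinitesimal
neighbourhoods / formal lifting tower along a closed subscheme,
Illusie obstruction classes for square-zero extensions of perfect complexes, Chern character into
complexBetti — requests filed);
the split of SectionalSource by witness type; the generality ladder ample divisor ⊂ c.i. ⊂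
'complement covered by k affines'
(cd(X∖Y) < k) — the decl takes the widest, HC still implies it for ANY morphism f; integral/torsion
refinements (deliberately
out: Kollar1992-type degree phenomena live one step outside the range, 2p = dim Y + 1); singular
sections (Bloch1990 barrier;
NodalSupport's territory); the Chow-level (not homological) weak Lefschetz conjecture, which is
stronger than anything HC needs.

CHEAPEST FALSIFIER. (1) Decl-shape check at p = 1: ThickCodimOne must be a consequence of Lefschetz
(1,1) + semisimplicity; if the affine-cover
hypothesis admitted a pair with H²(X) → H²(Y) non-injective inside the range the shape would be
wrong — checked by hand:
k affines ⇒ H^i(U) = 0 for i ≥ n + k (Andreotti–Frankel + Mayer–Vietoris) ⇒ injective for j ≤ n − k;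
degenerate instances
(s = ∅ forces f surjective hence an iso of reduced schemes; X a point) are consistent. (2) The
'generic member' sanity theorem:
for a very general member of a bpf system THICK is provable now on paper (spreading +
projective-bundle incidence variety +
Voisin II 3.33-type monodromy); a refuter who breaks this sketch has found the cheapest trouble. (3)
Card T5 calibration on
A × ℙ² with A a Weil-type abelian fourfold where HC is known (Markman2025SecantWeil): every class in
Alg ∩ im f^* on the conic
bundle H must descend — compute whether some representative passes the ≤ m₀ window. (4) Lean: the
deciding theorem `closes` elaborates in this
file (rev 3) and `lean check Sketch.lean` rc 0 (2026-08-15). (5) The ⊥-loophole of the filed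
SectionalSource (s = {⊥}, Y = X;
12:29Z review) is closed by the proper-section clause X∖f(Y) ≠ ∅ (rev 3); re-probe the restated decl
for degenerate witnesses
(Y a point needs |s| ≥ n affines by local cohomology, so only p = 0 survives, where algebraicClasses
X 0 = ⊤).

NUMBERS. Weak Lefschetz: H^k(X) → H^k(Y) iso for k < dim Y, injective for k = dim Y, Y an ample
(hyperplane) section with X∖Y smooth
(VoisinHodgeII2003 Thm 1.23, READ p.60); affine n-fold has the homotopy type of an n-dim CW complex
(Thm 1.22). Weak Lefschetz
conjecture for Chow groups: CH^p(X) → CH^p(L) iso for 2p < dim L, injective at 2p = dim L mod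
torsion (Sathyamoorthy2018WeakLefschetz
Conj. 1, READ p.1; Hartshorne1974Cycles). Leff(X,Y) for Y a c.i. in smooth X ⊂ ℙ^N needs dim Y ≥ 2
and fails for ℙ¹ ⊂ ℙ²
(Hartshorne1970 IV Thm 1.5, Ex. 1.6, READ p.100); cd(X∖Y) < n − 1 ⇔ Lef(X,Y) ∧ Y meets every divisor
(IV Prop 1.1, READ p.93).
Finite window: H¹(Z, N_{Z/Y} ⊗ N_{Y/X}^{−m}) = 0 for m ≫ 0 needs dim Z ≥ 2 (Serre duality), i.e.
p-cycles with dim ≥ 2, dim Y ≥ 3.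
Nori connectivity: H^k(X × T) → H^k(𝒴_T) iso for k < 2 dim Y, sufficiently ample c.i.
(VoisinHodgeII2003 Thm 8.1/8.4, READ p.199).
NL locus proper needs H^{2,0}_van ≠ 0 (Thm 3.33, READ p.107). Decl range: 2p + |s| ≤ dim X (|s| =
number of covering affines).

DEFINITION REQUESTS. LANDED (2026-08-15): (D1) infinitesimal neighbourhoods / formal neighbourhood
tower of a closed immersion —
Literature/AlgebraicGeometry/FormalGeometry/FormalNeighbourhoodTower.lean (real: Y_m, ι, transition,
incl; conormal pieces 𝓘^m/𝓘^{m+1} ≅ N^{−m} still listed 'Not here'); (D2) Chern character into ⊕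
complexBetti X (2i) — HodgeTheory/ChernCharacterBetti.lean (hypothesis structure on the real
carrier: ch of vector bundles, chVirtual of ℤ-combinations, span = algebraicClasses); (D3)
obstruction classes for perfect complexes across square-zero thickenings —
Deformation/SquareZeroExtensionObstruction.lean (POSITED carrier P.Perf; refuter junk-model warning)
and HodgeTheory/SemiregularityMap.lean (abstract Atiyah–trace layer, untwisted). FILED with the
repaired crux (for stmt-HodgeConjecture-13870): (D4) defn-VectorBundleExtensionObstruction — the
REAL propositions LiftsAlong i E₀ / LiftsFormally T E₀ for vector bundles (typable today:
Scheme.Modules.pullback + IsVectorBundle + FormalNeighbourhoodTower) and their classical obstruction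
theory in H^i(Z₀, 𝓔nd E₀ ⊗ 𝓘) anchored to real bundles (SGA1 III, Illusie1971 IV.3,
HuybrechtsThomas2010 Cor 3.4), plus the identification of the window groups H^i(Y, 𝓔nd E₀ ⊗ N^{−m});
(D5) defn-TwistedSemiregularityMap — the N^{−m}-twisted Buchweitz–Flenner components σ^L_k : H²(Y,
𝓔nd E₀ ⊗ L) → H^{k+2}(Y, Ω^k_Y ⊗ L) (BuchweitzFlenner2003 Def 4.1 with an invertible twist),
IsTwistedSemiregular / IsWindowSemiregular, and the Akizuki–Nakano vanishing H^i(Y, Ω^j ⊗ M^{−1}) =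
0 (i + j < d, M ample; DeligneIllusie1987 Cor 2.11) as a named fact. Still unfiled (needed only to
STATE (M) formally): Hodge-filtered de Rham cohomology H^{2q}(Z, Ω^{≥q}_Z) of a projective ℂ-scheme
with restriction maps and comparison to H^{2q}(Z_red(ℂ);ℂ).

Novelty: Searches (2026-08-15): lit search (local/hybrid) UNAVAILABLE all session (searchd down, 4 retries);
lit search --source zbmath
"weak Lefschetz Chow groups" → 15 rows: Sathyamoorthy2018WeakLefschetz (arXiv:1801.08610),
Paranjape1994SmallChow
(doi:10.2307/2118574), LewisShtayat2020 (doi:10.4153/s0008439520001022), PatelRavindra 2014 J.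
Algebra
(doi:10.1016/j.jalgebra.2013.09.051); zbmath "Hartshorne equivalence relations algebraic cycles" →
Hartshorne1974Cycles
(zbl:0314.14001); zbmath "Nori algebraic cycles Hodge theoretic connectivity" → Nori1993
(doi:10.1007/bf01231292); zbmath "Bloch
semi-regularity" → Bloch1972Semiregularity; lit galaxy search --star all/pdf/crabby "weak Lefschetz
(conjecture) for Chow groups",
"Grothendieck-Lefschetz theorem for Chow groups", "Noether-Lefschetz theorem for Chow groups" → 0
hits each; "variational Hodge
conjecture" --star pdf → 2 (Deligne–Milne notes, Costa–Sertöz 2003.11037); openalex/s2/arxiv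
rate-limited (429). READ: Hartshorne1970
pp.66,93,100 (held book); VoisinHodgeII2003 pp.59–61,107–108,178,191–192,199–201; arXiv:1801.08610
pp.1–2; the three parallel
route files AnchorTransport/NodalSupport/QbarEnvelope (opened 10:50Z). Card audit
(refuter-novelty-audit-8-0) graded the card
new-combination with prior art Hartshorne1974Cycles, PatelRavindra2014
(doi:10.4310/hha.2014.v16.n2.a4), PatelRavindra2017
(doi:10.1016/j.jpaa.2016.10.019), arXiv:1801.08610.
Nearest prior art found: Hartshorne1974Cycles / Sathyamoorthy2018WeakLefschetz Conj. 1  [refs: 10.2307/2118574, 10.4153/s0008439520001022, 10.1016/j.jalgebra.2013.09.051, 10.1007/bf01231292, 10.4310/hha.2014.v16.n2.a4, 10.1016/j.jpaa.2016.10.019, 1801.08610, doi:10.2307/2118574, doi:10.4153/s0008439520001022, doi:10.1016/j.jalgebra.2013.09.051, doi:10.1007/bf01231292, doi:10.4310/hha.2014.v16.n2.a4, doi:10.1016/j.jpaa.2016.10.019, LewisShtayat2020, Nori1993, Hartshorne1970, VoisinHodgeII200]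

Barriers (technique_class: formal-geometry, weak-lefschetz, semiregularity): - technique_class: formal-geometry, weak-lefschetz, semiregularity
- Literature.Barriers.HodgeConjecture.Clemens1983_griffithsGroup_infiniteRank: evaded — THICK is
stated modulo HOMOLOGICAL equivalence with ℂ/ℚ-coefficients (finite-dimensional spaces
algebraicClasses), never for CH^p(X) → CH^p(Y) itself; infinite rank of Griffiths groups (Nori1993,
Clemens) obstructs only the Chow-level conjecture, which the route does not need.
- Literature.Barriers.HodgeConjecture.Voisin2003_generalHypersurface_noIntegralClassInF: evaded — no
Lefschetz pencil, no normal functions, no Jacobi inversion: classes are EXTENDED off a fixed smooth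
section in the sub-middle range 2p + k ≤ dim X where f^* is injective, and cycles enter through
deformation/obstruction theory of objects, not through intermediate Jacobians.
- Literature.Barriers.HodgeConjecture.AtiyahHirzebruch1962_torsionClass_notAlgebraic: evaded — all
statements are in H^{2p}(–;ℂ) with rational classes (IsRationalClass), torsion invisible.
- Literature.Barriers.HodgeConjecture.Kollar1992_nonTorsionClass_notAlgebraic: evaded —
ℚ-coefficients; the integral analogue of THICK fails by degree divisibility only one step OUTSIDE
the decl's range (curves on a very general threefold Y ⊂ ℙ⁴: 2p = 4 = dim Y + 1).
-
Literature.Barriers.HodgeConjecture.Bloch1990_cohomologicalHodgeConjecture_singular_counterexample: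
evaded — Y and X are SMOOTH projective (IsSmoothProjective in every decl), algebraicClasses = Nᵖ of
a smooth variety; the K-theoreti

History (route lifecycle, newest last):
- 2026-08-15T11:08:17Z · rev 1: restated Target (stmt-HodgeConjecture-2612) — render Target: expand ThickDescent ∧ SectionalSource into terms (Target precedes the crux decls in the file) (planner-plancard-HodgeConjecture-HodgeConject-5215a5e4-0)
- 2026-08-15T16:22:05Z · rev 3: restated SectionalSource (stmt-HodgeConjecture-2614), Target (stmt-HodgeConjecture-2781), Assembly (stmt-HodgeConjecture-2619) — route-repair (rbadge g2, glue+cone): (i) glue PROVED — closes : ThickDescent → SectionalSource → WeakLefschetzInjective → HardLefschetzReduction → MiddleStabili (planner-rbadge-HodgeConjecture-AmpleAdicLefsch-43de99fd-g2-0)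
- 2026-08-15T21:34:12Z · rev 4: dropped stmt-HodgeConjecture-13871, stmt-HodgeConjecture-2686 — repair (route-repair, refuted-misstated): HadicSemiregularLift stmt-HodgeConjecture-2686 (informal engine crux, no decl) was refuted-misstated by the refuter cr (planner-rrefute-HodgeConjecture-AmpleAdicLefsc-307e9047-0)
- 2026-08-17T10:54:04Z · skeleton.hides-summit: stub_hodgeMiddle (stmt-HodgeConjecture-10725) ⟷ summit (accepted theorem in Summits/HodgeConjecture/HodgeConjecture/Theorems/AmpleAdicLefschetzSectionalSourceIffHodgeConjecture.lean) (prover-line-stmt-HodgeConjecture-10725-c1-0)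
- 2026-08-17T11:19:29Z · CLOSED exhausted — exhausted (planner-rbadge-HodgeConjecture-AmpleAdicLefsch-43de99fd-g3-0)

sub-problem: HodgeConjecture · status: closed(exhausted) · opened planner-plancard-HodgeConjecture-HodgeConject-5215a5e4-0 2026-08-15T11:06:12Z · rev 7 · ledger route-HodgeConjecture-AmpleAdicLefschetz
GENERATED by the gate from the ledger (D-0016/17). Provers cite these decls: `theorem foo : Summit.HodgeConjecture.HodgeConjecture.Theses.AmpleAdicLefschetz.<Decl> := …` in Summits/HodgeConjecture/HodgeConjecture/Theorems/<Name>.lean.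
-/

namespace Summit.HodgeConjecture.HodgeConjecture.Theses.AmpleAdicLefschetz

open scoped BigOperators Topology Manifold Classical MeasureTheory ProbabilityTheory Matrix InnerProductSpace ComplexConjugate ContinuousMap
open Filter Set Function TopologicalSpace MeasureTheory

attribute [summit_statement] _root_.HodgeConjecture

-- earlier Target (stmt-HodgeConjecture-2612, replaced 2026-08-15T11:08:17Z -> stmt-HodgeConjecture-2781): retired by None — ThickDescent ∧ SectionalSource
-- earlier Target (stmt-HodgeConjecture-2781, replaced 2026-08-15T16:22:05Z -> stmt-HodgeConjecture-10726): retired by None — (∀ ⦃n m p : ℕ⦄ ⦃X Y : Literature.AlgebraicGeometry.Motives.SchemeOver ℂ⦄ (f : Y ⟶ X), Literature.AlgebraicGeometry.Motives.IsSmoothProjective n X → Literature.AlgebraicGeometry.Motives.IsSmoothProjective m Y → AlgebraicGeometry.IsClosedImmersion f.left → ∀ (s : Finset X.left.O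
/-- item stmt-HodgeConjecture-10726 · target · rank 0 · closed · moot by None · by planner
why it might fail: Jointly of HC strength (HC ⇒ THICK by semisimplicity of polarisable Hodge structures; HC ⇒ SS via Bertini + pull-back); fails iff HC fails. SS alone fails for a 'sectionally isolated' Hodge class.
sources: Hartshorne1974Cycles, Sathyamoorthy2018WeakLefschetz, VoisinHodgeII2003, Deligne2000
[target] X = THICK ∧ SS, written out as the conjunction of the two crux terms (ThickDescent ∧
SectionalSource in its proper-section form of rev 3; the decl names cannot be referenced here
because Target is rendered before the cruxes; `Target ↔ ThickDescent ∧ SectionalSource` is Iff.rfl):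
algebraicity descends from affine-complement sections in the range 2p + k ≤ dim X, and every Hodge
class below the middle is algebraic on at least one PROPER such section. -/
@[route_item "route-HodgeConjecture-AmpleAdicLefschetz"]
def Target : Prop :=
  (∀ ⦃n m p : ℕ⦄ ⦃X Y : Literature.AlgebraicGeometry.Motives.SchemeOver ℂ⦄ (f : Y ⟶ X), Literature.AlgebraicGeometry.Motives.IsSmoothProjective n X → Literature.AlgebraicGeometry.Motives.IsSmoothProjective m Y → AlgebraicGeometry.IsClosedImmersion f.left → ∀ (s : Finset X.left.Opens), (∀ U ∈ s, AlgebraicGeometry.IsAffineOpen U) → (⋃ U ∈ s, (U : Set X.left)) = (Set.range f.left.base)ᶜ → 2 * p + s.card ≤ n → ∀ c ∈ Literature.AlgebraicGeometry.HodgeTheory.algebraicClasses Y p, c ∈ LinearMap.range (Literature.AlgebraicGeometry.HodgeTheory.complexBetti.map f (2 * p)).hom → ∃ a ∈ Literature.AlgebraicGeometry.HodgeTheory.algebraicClasses X p, Literature.AlgebraicGeometry.HodgeTheory.complexBetti.map f (2 * p) a = c) ∧ (∀ ⦃n p : ℕ⦄ ⦃X : Literature.AlgebraicGeometry.Motives.SchemeOver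 ℂ⦄, Literature.AlgebraicGeometry.Motives.IsSmoothProjective n X → 2 * p + 1 ≤ n → ∀ c : Literature.AlgebraicGeometry.HodgeTheory.complexBetti X (2 * p), Literature.AlgebraicGeometry.HodgeTheory.IsRationalClass c → Literature.AlgebraicGeometry.HodgeTheory.IsOfHodgeType n X (2 * p) p p c → ∃ (m : ℕ) (Y : Literature.AlgebraicGeometry.Motives.SchemeOver ℂ) (f : Y ⟶ X) (s : Finset X.left.Opens), Literature.AlgebraicGeometry.Motives.IsSmoothProjective m Y ∧ AlgebraicGeometry.IsClosedImmersion f.left ∧ (∀ U ∈ s, AlgebraicGeometry.IsAffineOpen U) ∧ (⋃ U ∈ s, (U : Set X.left)) = (Set.range f.left.base)ᶜ ∧ 2 * p + s.card ≤ n ∧ Set.Nonempty (Set.range f.left.base)ᶜ ∧ Literature.AlgebraicGeometry.HodgeTheory.complexBetti.map f (2 * p) c ∈ Literature.AlgebraicGeometry.HodgeTheory.algebraicClasses Y p)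

/-- item stmt-HodgeConjecture-2613 · crux · rank 2 · closed · moot by None · by planner
why it might fail: HC-implied (ThickNecessary), so false only with HC; live risk is the engines: at SPECIAL sections unobstructed/semiregular representatives may not exist (non-lci, Ext² ≠ 0 though the Hodge obstruction vanishes) and BEK-type algebraization of K-classes is open.
sources: Hartshorne1974Cycles, Sathyamoorthy2018WeakLefschetz, PatelRavindra2014, PatelRavindra2017, Hartshorne1970, Grothendieck1968SGA2
[crux] THICK (card Lemma 1 / THICK and THICK' merged): f : Y ⟶ X a closed immersion of smooth
projective ℂ-varieties (dim X = n, dim Y = m), s a finite set of affine opens of X covering exactly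
X∖f(Y), 2p + |s| ≤ n; then every c ∈ algebraicClasses Y p that lies in the range of f^* on H^{2p}
equals f^*a for some a ∈ algebraicClasses X p. Covers smooth ample divisors (|s| = 1, 2p ≤ dim Y:
Lefschetz range and boundary) and smooth complete intersections of |s| ample divisors; trivial for
|s| = 0 (f iso). ℚ/ℂ-coefficients, modulo homological equivalence only. [difficulty: open-problem] -/
@[route_item "route-HodgeConjecture-AmpleAdicLefschetz"]
def ThickDescent : Prop :=
  ∀ ⦃n m p : ℕ⦄ ⦃X Y : Literature.AlgebraicGeometry.Motives.SchemeOver ℂ⦄ (f : Y ⟶ X), Literature.AlgebraicGeometry.Motives.IsSmoothProjective n X → Literature.AlgebraicGeometry.Motives.IsSmoothProjective m Y → AlgebraicGeometry.IsClosedImmersion f.left → ∀ (s : Finset X.left.Opens), (∀ U ∈ s, AlgebraicGeometry.IsAffineOpen U) → (⋃ U ∈ s, (U : Set X.left)) = (Set.range f.left.base)ᶜ → 2 * p + s.card ≤ n → ∀ c ∈ Literature.AlgebraicGeometry.HodgeTheory.algebraicClasses Y p, c ∈ LinearMap.range (Literature.AlgebraicGeometry.HodgeTheory.complexBetti.map f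 (2 * p)).hom → ∃ a ∈ Literature.AlgebraicGeometry.HodgeTheory.algebraicClasses X p, Literature.AlgebraicGeometry.HodgeTheory.complexBetti.map f (2 * p) a = c

-- earlier SectionalSource (stmt-HodgeConjecture-2614, replaced 2026-08-15T16:22:05Z -> stmt-HodgeConjecture-10725): retired by None — ∀ ⦃n p : ℕ⦄ ⦃X : Literature.AlgebraicGeometry.Motives.SchemeOver ℂ⦄, Literature.AlgebraicGeometry.Motives.IsSmoothProjective n X → 2 * p + 1 ≤ n → ∀ c : Literature.AlgebraicGeometry.HodgeTheory.complexBetti X (2 * p), Literature.AlgebraicGeometry.HodgeTheory.IsRationa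
/-- item stmt-HodgeConjecture-10725 · crux · rank 3 · closed · moot by None · by planner
why it might fail: HC-strength given THICK: for very general sections f^*c algebraic already forces c algebraic (spreading), so witnesses live in NL-special members — a countable union of proper subvarieties (CDK; Voisin II 3.33); a rigid 'sectionally isolated' class kills it.
sources: VoisinHodgeII2003, CattaniDeligneKaplan1995JAMS, Otwinowska2002, BaldiKlinglerUllmo2024, ConteMurre1978, Zucker1977CubicFourfolds
[crux] SS (restated 2026-08-15, proper section): for X smooth projective of dim n, 2p + 1 ≤ n, and c
a rational (p,p) class in H^{2p}(X(ℂ);ℂ), there exist a smooth projective Y of some dim m, a closed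
immersion f : Y ⟶ X with X∖f(Y) NON-EMPTY (Y is a proper section) and a finite set s of affine opens
of X covering exactly X∖f(Y) with 2p + |s| ≤ n (hence 1 ≤ |s| ≤ n − 2p), such that f^*c ∈
algebraicClasses Y p. I.e. every Hodge class below the middle becomes algebraic on some PROPER
section of ample type (a smooth ample divisor, or a smooth c.i. of ≤ n − 2p ample divisors, possibly
very special: through a given p-fold, Noether–Lefschetz-special, or a member where HC is known —
Fano/uniruled fourfold sections by ConteMurre1978, cubic fourfolds by Zucker1977CubicFourfolds,
Fermat members). Restatement note (refuter reviews 12:29Z/13:59Z on stmt-HodgeConjecture-2614): the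
filed form asked only `0 < s.card`, which the EMPTY affine open ⊥ satisfies with Y = X, f = 𝟙, s =
{⊥}, making the filed SS equivalent to HC below the middle and its kill criterion unrealisable; the
clause `Set.Nonempty (Set.range f.left.base)ᶜ` closes that loophole and implies `0 < s.card`
(planner Sketch.lean: secti -/
@[route_item "route-HodgeConjecture-AmpleAdicLefschetz"]
def SectionalSource : Prop :=
  ∀ ⦃n p : ℕ⦄ ⦃X : Literature.AlgebraicGeometry.Motives.SchemeOver ℂ⦄, Literature.AlgebraicGeometry.Motives.IsSmoothProjective n X → 2 * p + 1 ≤ n → ∀ c : Literature.AlgebraicGeometry.HodgeTheory.complexBetti X (2 * p), Literature.AlgebraicGeometry.HodgeTheory.IsRationalClass c → Literature.AlgebraicGeometry.HodgeTheory.IsOfHodgeType n X (2 * p) p p c → ∃ (m : ℕ) (Y : Literature.AlgebraicGeometry.Motives.SchemeOver ℂ) (f : Y ⟶ X) (s : Finset X.left.Opens), Literature.AlgebraicGeometry.Motives.IsSmoothProjective m Y ∧ AlgebraicGeometry.IsClosedImmersion f.left ∧ (∀ U ∈ s, AlgebraicGeometry.IsAffineOpen U) ∧ (⋃ U ∈ s,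 (U : Set X.left)) = (Set.range f.left.base)ᶜ ∧ 2 * p + s.card ≤ n ∧ Set.Nonempty (Set.range f.left.base)ᶜ ∧ Literature.AlgebraicGeometry.HodgeTheory.complexBetti.map f (2 * p) c ∈ Literature.AlgebraicGeometry.HodgeTheory.algebraicClasses Y p

-- item stmt-HodgeConjecture-13870 · crux · rank 4 · closed · moot by None · by planner — informal only, no Lean statement yet:
--   [crux] ENGINE of ThickDescent at a FIXED (possibly special) smooth ample divisor — repaired
--   HadicSemiregularLift (stmt-HodgeConjecture-2686 refuted-misstated, CRUX-ATTACK-2686.md §§2,5,7):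
--   VECTOR BUNDLES ONLY, up to positive integer multiples, per-summand all-degree normalisation,
--   mechanism (M)+(S) instead of the existential form (which restates ThickDescent); informal until
--   twisted Atiyah/trace maps and bundle-extension obstructions have real carriers. SETTING: X smooth
--   projective /ℂ, dim X = n; f : Y ⟶ X a smooth AMPLE divisor, d = dim Y = n−1 ≥ 3; N = O_X(Y)|_Y; Y =
--   Y₀ ⊂ Y₁ ⊂ … the infinite

/-- item stmt-HodgeConjecture-1084 · support · rank 9 · closed · proved by Summit.HodgeConjecture.HodgeConjecture.Theorems.linearSystemTorelli_hardLefschetzReduction_proof @ fc8b66396040 (prover) · by planner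
sources: Kleiman1968, Thomas2005Nodes, KerrPearlstein2011
[support] Hard-Lefschetz reduction above the middle (theorem in print): for n < 2p on a smooth
projective n-fold, HC in codimension n−p implies HC in codimension p — L^{2p−n} : H^{2n−2p} → H^{2p}
is an isomorphism of Hodge structures (VoisinHodgeI2002 Thm 6.25) so a rational (p,p) class is
L^{2p−n} of a rational (n−p,n−p) class, and cup product with powers of the hyperplane class
preserves algebraicity (move the hyperplanes; cf.
HardLefschetzThreefold.lefschetzOperator_mem_algebraicClasses). For p > n both sides are trivial
(H^{2p} = 0 above real dimension; truncated n − p = 0 and algebraicClasses X 0 = ⊤). -/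
@[route_item "route-HodgeConjecture-AmpleAdicLefschetz"]
def HardLefschetzReduction : Prop :=
  ∀ (n p : ℕ), n < 2 * p → ∀ ⦃X : Literature.AlgebraicGeometry.Motives.SchemeOver ℂ⦄, Literature.AlgebraicGeometry.Motives.IsSmoothProjective n X → (∀ c : Literature.AlgebraicGeometry.HodgeTheory.complexBetti X (2 * (n - p)), Literature.AlgebraicGeometry.HodgeTheory.IsRationalClass c → Literature.AlgebraicGeometry.HodgeTheory.IsOfHodgeType n X (2 * (n - p)) (n - p) (n - p) c → c ∈ Literature.AlgebraicGeometry.HodgeTheory.algebraicClasses X (n - p)) → ∀ c : Literature.AlgebraicGeometry.HodgeTheory.complexBetti X (2 * p), Literature.AlgebraicGeometry.HodgeTheory.IsRationalClass c → Literature.AlgebraicGeometry.HodgeTheory.IsOfHodgeType n X (2 * p) p p c → c ∈ Literature.AlgebraicGeometry.HodgeTheory.algebraicClasses X p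

/-- `HardLefschetzReduction` holds: proved by `Summit.HodgeConjecture.HodgeConjecture.Theorems.linearSystemTorelli_hardLefschetzReduction_proof` @ fc8b66396040. -/
theorem HardLefschetzReduction_holds : HardLefschetzReduction := _root_.Summit.HodgeConjecture.HodgeConjecture.Theorems.linearSystemTorelli_hardLefschetzReduction_proof

/-- item stmt-HodgeConjecture-14258 · support · rank 9 · closed · proved by Summit.HodgeConjecture.HodgeConjecture.Theorems.ampleAdicLefschetz_targetOfCruxes_proof @ 54df80d7053a (prover) · by planner
[support] GLUE Crux… → Target (route-choice repair 2026-08-16, reason target-unreachable: no item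
concluded the target): the two cruxes imply the target X = THICK ∧ SS. Provable NOW in one line —
`Target` is rendered as the literal conjunction of the ThickDescent term and the SectionalSource
term (Target precedes the crux decls in the file, so it cannot name them), hence `theorem … :
TargetOfCruxes := fun hT hS => ⟨hT, hS⟩` closes this item and `Target ↔ ThickDescent ∧
SectionalSource` is `Iff.rfl` (planner Sketch.lean, lean check rc 0, 0 sorries, 2026-08-16). With it
the item graph reads ThickDescent, SectionalSource → Target (this item) and the deciding theorem
`closes : ThickDescent → SectionalSource → WeakLefschetzInjective → HardLefschetzReduction →
MiddleStabilisation → HodgeModelsExist → HodgeConjecture` factors through Target (`closes hX.1 hX.2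
hW hH hMid hM`, also checked in Sketch.lean). [deps: ThickDescent, SectionalSource, Target]
[difficulty: provable-now] -/
@[route_item "route-HodgeConjecture-AmpleAdicLefschetz"]
def TargetOfCruxes : Prop :=
  ThickDescent → SectionalSource → Target

/-- item stmt-HodgeConjecture-15189 · support · rank 9 · closed · moot by None · by planner
[support] ALGEBRAIC CLASSES ARE OF HODGE TYPE (p,p) IN EVERY HODGE MODEL (route-choice repair
2026-08-16, unit rchoice-Summits-HodgeConjecture-HodgeC-53724b8b; RE-ROUTE, not promote): for X
smooth projective /ℂ of dim n, every Hodge model A of X, every p and every c ∈ algebraicClasses X p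
= Nᵖ H²ᵖ(X(ℂ);ℂ), the pull-back A.pullback (2p) c lies in A.hodgePQ (2p) p p — "the class of an
algebraic cycle is of type (p,p)" (Deligne 2000 §1; Voisin I Prop. 11.20; Fulton §19.1 Lemma 19.1.1
for Nᵖ H²ᵖ = span of cycle classes). It is the i = 2p SLICE of the XL-apex named fact
Literature.Barriers.HodgeConjecture.Grothendieck1969_supportedClasses_le_hodgeFiltration ((∗), p.
299: Nᵖ Hⁱ ⊆ Fᵖ Hⁱ for ALL i), on which the landed Theorems/AmpleAdicLefschetzThickNecessary made
ThickNecessary (stmt-HodgeConjecture-2617) conditional; (∗) is used there at exactly one place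
(mem_hodgeClasses_of_ofRatClass_mem_algebraicClasses, i = 2p). WHY AN ITEM AND NOT (∗) AS A CRUX:
(∗) for all degrees is discharged only through Deligne, Hodge III Cor. 8.2.8
(Deligne1974_ker_restrictCompl_eq_iSup_range_complexGysin, mixed Hodge theory;
SupportedClassesHodgeConiveauProofs …_of_deligne — every other input is PROVED: non -/
@[route_item "route-HodgeConjecture-AmpleAdicLefschetz"]
def AlgebraicClassesHodgeType : Prop :=
  ∀ ⦃n : ℕ⦄ ⦃X : Literature.AlgebraicGeometry.Motives.SchemeOver ℂ⦄, Literature.AlgebraicGeometry.Motives.IsSmoothProjective n X → ∀ (A : Literature.AlgebraicGeometry.HodgeTheory.HodgeModel n X) (p : ℕ), ∀ c ∈ Literature.AlgebraicGeometry.HodgeTheory.algebraicClasses X p, A.pullback (2 * p) c ∈ A.hodgePQ (2 * p) p p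

/-- item stmt-HodgeConjecture-2615 · support · rank 9 · closed · proved by Summit.HodgeConjecture.HodgeConjecture.Theorems.weakLefschetzInjective_proof @ ad5808fa8772 (prover) · by planner
sources: VoisinHodgeII2003, Milnor1963
[support] Weak Lefschetz, injectivity half, in affine-cover form: X smooth projective of dim n, f :
Y ⟶ X a closed immersion, X∖f(Y) covered by the k affine opens of s; then f^* : H^j(X(ℂ);ℂ) →
H^j(Y(ℂ);ℂ) is injective for j + k ≤ n. Proof in print: U = X∖Y is a union of k smooth affine
varieties, all finite intersections affine (X separated), so H^i(U(ℂ)) = 0 for i > n + k − 1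
(Andreotti–Frankel, Voisin II Thm 1.22, + Mayer–Vietoris), Poincaré duality on U gives H^j_c(U) = 0
for j ≤ n − k, and the compact-support sequence of (X, Y) gives injectivity (Voisin II Thm 1.23 is
the case k = 1). Needs on the tree's carriers: Mayer–Vietoris/compact supports for
singularCohomology of complex points, Andreotti–Frankel. [difficulty: L] -/
@[route_item "route-HodgeConjecture-AmpleAdicLefschetz", crux]
def WeakLefschetzInjective : Prop :=
  ∀ ⦃n : ℕ⦄ ⦃X Y : Literature.AlgebraicGeometry.Motives.SchemeOver ℂ⦄ (f : Y ⟶ X), Literature.AlgebraicGeometry.Motives.IsSmoothProjective n X → AlgebraicGeometry.IsClosedImmersion f.left → ∀ (s : Finset X.left.Opens), (∀ U ∈ s, AlgebraicGeometry.IsAffineOpen U) → (⋃ U ∈ s, (U : Set X.left)) = (Set.range f.left.base)ᶜ → ∀ (j : ℕ), j + s.card ≤ n → Function.Injective (Literature.AlgebraicGeometry.HodgeTheory.complexBetti.map f j)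

/-- item stmt-HodgeConjecture-2616 · support · rank 9 · closed · proved by Summit.HodgeConjecture.HodgeConjecture.Theorems.ampleAdicLefschetz_middleStabilisation_proof @ cfe9b053e7fe (prover) · by planner
sources: Fulton1998, Kleiman1968, VoisinHodgeI2002
[support] Middle degree from one dimension up: if rational (p,p) classes are algebraic on every
smooth projective X' of dimension 2p + 1 (degree 2p, i.e. the range 2p + 1 ≤ dim), then rational
(p,p) classes are algebraic on every smooth projective X of dimension 2p. Proof in print (folklore
product trick): X' = X × ℙ¹ (IsSmoothProjective.tensor_holds,
isSmoothProjective_projectiveSpace_holds), c' = pr_X^* c is rational (IsRationalClass.map) and of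
type (p,p) (pull-back of Hodge type — Literature lemma to add), c' algebraic by hypothesis, c =
s^*c' for the section s = (id, pt), and pull-back preserves algebraic classes
(QbarEnvelope.PullbackAlgebraic, Fulton §8.1/Cor. 19.2). [difficulty: M] -/
@[route_item "route-HodgeConjecture-AmpleAdicLefschetz"]
def MiddleStabilisation : Prop :=
  ∀ (p : ℕ), (∀ ⦃X' : Literature.AlgebraicGeometry.Motives.SchemeOver ℂ⦄, Literature.AlgebraicGeometry.Motives.IsSmoothProjective (2 * p + 1) X' → ∀ c' : Literature.AlgebraicGeometry.HodgeTheory.complexBetti X' (2 * p), Literature.AlgebraicGeometry.HodgeTheory.IsRationalClass c' → Literature.AlgebraicGeometry.HodgeTheory.IsOfHodgeType (2 * p + 1) X' (2 * p) p p c' → c' ∈ Literature.AlgebraicGeometry.HodgeTheory.algebraicClasses X' p) → ∀ ⦃X : Literature.AlgebraicGeometry.Motives.SchemeOver ℂ⦄, Literature.AlgebraicGeometry.Motives.IsSmoothProjective (2 * p) X → ∀ c : Literature.AlgebraicGeometry.HodgeTheory.complexBetti X (2 * p), Literature.AlgebraicGeometry.HodgeTheory.IsRationalClass c → Literature.AlgebraicGeometry.HodgeTheory.IsOfHodgeType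 (2 * p) X (2 * p) p p c → c ∈ Literature.AlgebraicGeometry.HodgeTheory.algebraicClasses X p

/-- item stmt-HodgeConjecture-2617 · support · rank 9 · closed · moot by None · by planner
sources: Deligne2000, VoisinHodgeI2002, CharlesSchnell2014Notes
[support] THICK is a CONSEQUENCE of the Hodge conjecture (so ¬ThickDescent refutes the summit):
given HC and c ∈ Alg^p(Y) ∩ im f^*, write Alg^p(Y)_ℂ ∩ im f^*_ℂ = (Alg^p(Y)_ℚ ∩ im f^*_ℚ) ⊗ ℂ (both
subspaces are ℚ-rational: supportedClasses are spanned by rational classes,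
SupportedClassesRational; universal coefficients), lift each rational Hodge generator through f^* to
a rational (p,p) class of X using semisimplicity of polarisable ℚ-Hodge structures (H^{2p}(X) = ker
f^* ⊕ M, f^*|_M strict injective), and apply HC on X. Needs on the tree: algebraic ⇒ Hodge
(Grothendieck1969 fact supportedClasses_le_hodgeConiveau + conjugation), polarisation/semisimplicity
for HodgeModel. [difficulty: L] -/
@[route_item "route-HodgeConjecture-AmpleAdicLefschetz"]
def ThickNecessary : Prop :=
  _root_.HodgeConjecture → ThickDescent

/-- item stmt-HodgeConjecture-2618 · support · rank 9 · closed · moot by None · by planner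
sources: Hartshorne1970, Grothendieck1968SGA2, VoisinHodgeI2002
[support] Calibration p = 1 of ThickDescent (literally its instance, and a THEOREM in print):
divisor classes on Y in the image of f^* come from divisor classes on X — Lefschetz (1,1) on X and Y
(tree fact lefschetzOneOne_rational) plus the semisimplicity lift of ThickNecessary; for Y a smooth
ample divisor of dim ≥ 3 this is Grothendieck–Lefschetz Pic ⊗ ℚ modulo homological equivalence
(Hartshorne1970 IV Cor. 3.3). [difficulty: M] -/
@[route_item "route-HodgeConjecture-AmpleAdicLefschetz"]
def ThickCodimOne : Prop :=
  ∀ ⦃n m : ℕ⦄ ⦃X Y : Literature.AlgebraicGeometry.Motives.SchemeOver ℂ⦄ (f : Y ⟶ X), Literature.AlgebraicGeometry.Motives.IsSmoothProjective n X → Literature.AlgebraicGeometry.Motives.IsSmoothProjective m Y → AlgebraicGeometry.IsClosedImmersion f.left → ∀ (s : Finset X.left.Opens), (∀ U ∈ s, AlgebraicGeometry.IsAffineOpen U) → (⋃ U ∈ s, (U : Set X.left)) = (Set.range f.left.base)ᶜ → 2 * 1 + s.card ≤ n → ∀ c ∈ Literature.AlgebraicGeometry.HodgeTheory.algebraicClasses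 Y 1, c ∈ LinearMap.range (Literature.AlgebraicGeometry.HodgeTheory.complexBetti.map f (2 * 1)).hom → ∃ a ∈ Literature.AlgebraicGeometry.HodgeTheory.algebraicClasses X 1, Literature.AlgebraicGeometry.HodgeTheory.complexBetti.map f (2 * 1) a = c

/-- item stmt-HodgeConjecture-2742 · support · rank 9 · closed · proved by Summit.HodgeConjecture.HodgeConjecture.Theorems.holomorphicDefect_hodgeModelsExist_proof @ 852a466105f7 (prover) · by planner
[support] = ∀ n X, Literature.AlgebraicGeometry.HodgeTheory.nonempty_hodgeModel n X (Serre GAGA §2 +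
de Rham + the Hodge decomposition of the compact Kähler X^an); tree named fact, discharge in
progress (HodgeModelExistenceDischarge). [difficulty: L] -/
@[route_item "route-HodgeConjecture-AmpleAdicLefschetz"]
def HodgeModelsExist : Prop :=
  ∀ (n : ℕ) (X : Literature.AlgebraicGeometry.Motives.SchemeOver ℂ), Literature.AlgebraicGeometry.Motives.IsSmoothProjective n X → Nonempty (Literature.AlgebraicGeometry.HodgeTheory.HodgeModel n X)

/-- `HodgeModelsExist` holds: proved by `Summit.HodgeConjecture.HodgeConjecture.Theorems.holomorphicDefect_hodgeModelsExist_proof` @ 852a466105f7. -/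
theorem HodgeModelsExist_holds : HodgeModelsExist := _root_.Summit.HodgeConjecture.HodgeConjecture.Theorems.holomorphicDefect_hodgeModelsExist_proof

-- earlier Assembly (stmt-HodgeConjecture-2619, replaced 2026-08-15T16:22:05Z -> stmt-HodgeConjecture-10727): retired by None — (∀ (n : ℕ) (X : Literature.AlgebraicGeometry.Motives.SchemeOver ℂ), Literature.AlgebraicGeometry.HodgeTheory.nonempty_hodgeModel n X) → WeakLefschetzInjective → HardLefschetzReduction → MiddleStabilisation → ThickDescent → SectionalSource → _root_.HodgeConjecture
/-- item stmt-HodgeConjecture-10727 · assembly · rank 1 · closed · proved by Summit.HodgeConjecture.HodgeConjecture.Theorems.ampleAdicLefschetz_assembly_proof @ ba2961f2041f (prover) · by planner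
sources: Deligne2000, VoisinHodgeII2003
[assembly] HodgeModelsExist → WeakLefschetzInjective → HardLefschetzReduction → MiddleStabilisation
→ ThickDescent → SectionalSource → HodgeConjecture: the deciding theorem `closes` of this file
(D-0027 §2.1, sorry-free) re-curried — provable NOW in one line, `fun hM hW hH hMid hT hS => closes
hT hS hW hH hMid hM` (planner Sketch.lean: assembly_of_closes). Route-repair 2026-08-15: the rev ≤ 2
antecedent `∀ n X, nonempty_hodgeModel n X` (an unlisted Literature fact) is replaced by the listed
item HodgeModelsExist (the same proposition with the fact's binders spelled out; needs-fact:
Literature.AlgebraicGeometry.HodgeTheory.nonempty_hodgeModel), and the import of HodgeModelExistence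
is dropped. -/
@[route_item "route-HodgeConjecture-AmpleAdicLefschetz"]
def Assembly : Prop :=
  HodgeModelsExist → WeakLefschetzInjective → HardLefschetzReduction → MiddleStabilisation → ThickDescent → SectionalSource → _root_.HodgeConjecture

end Summit.HodgeConjecture.HodgeConjecture.Theses.AmpleAdicLefschetz
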